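import Summits.CriticalPhenomena.PercolationContinuityZ3.Theorems.PercNearOneGluingNoHeavyLowerTailMajorityGluingQCertSort2
import HarnessLib

/-!
# Symmetrised (orbit-key) degree-2 certificates: the language and the kernel check (lane prim-rate, constants-miner 1, gen 36; CANDIDATES §GEN-36, NEXT-g37)

Support file for the closed crux `NoHeavyLowerTail` (stmt-CriticalPhenomena-4575), majority-gluing line.  The degree-2 certificate language of
`…MajorityGluingQCert` (multiplier `ℓ·(cN·x_D − cD·T)`, marginal slacks `(x_D − m_x)·x_b`, hub-rooted van den Berg–Kahn rows, squares of mask forms)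
WITHOUT the case chain, checked UP TO THE SYMMETRY of relabelling the `m` relays: every contribution `z·x_i x_j` of the expanded identity is filed under
the ORBIT KEY `keyS m i j` of the pair `(i, j)` — the code of a canonical pair `(σ•i, σ•j)` obtained by sorting the relays by their membership classes
(`classList`, `unrank`, `pull`) — and the check `SymCert.checkQS` asks that every key class has a nonnegative coefficient SUM (sort by key with `msort2`,
scan with `runsOK`).  This is sound because the symmetrised second moments `Σ_g v_g(i)·v_g(j)` of the family of relabelled cut laws depend on the orbit of
`(i, j)` only (`…MajorityGluingQCertSymPerm`), so a certificate needs ONE representative per orbit of rows instead of the whole orbit: the `(8,5)` cell, which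
took 1 333 row instances and 86 kernel chunks at `27/20` (`…QCertEightFive135*`), has an orbit certificate with a handful of rows, and the cells `m = 9 … 12`
(`|A| = 11 … 15`) come within reach of the kernel.  This file: `pull` (relabelled pattern), `classList`/`unrank` (the canonical relabelling of a pair),
`canonPair`, `keyS`, the certificate structure `SymCert`, its contribution list `contribsS`, the structural check `checkWS` and the key check `checkQS`
(all computable: pure list / integer arithmetic), followed by the OBJECTS of the soundness proof: the symmetrised moments `Msym`, the key valuation `valS`,
the `ℕ`-extension `permN` of a permutation, the canonical relabelling as a permutation `classPerm` (`classList_perm`), and the family `lawFam` of cut laws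
of all relabellings of an enumeration of relays.  Soundness: `…MajorityGluingQCertSymSound` (abstract, over a finite family of points),
`…MajorityGluingQCertSymPerm` (the orbit property) and `…MajorityGluingQCertSymCount` (percolation: `cut_of_checkS_count`).  No sorries.
-/

namespace Summit.CriticalPhenomena.PercolationContinuityZ3.Theorems

namespace HubOnly
namespace QCert

/-! ### Relabelled patterns and the canonical form of a pair -/

/-- **Relabelled pattern:** for `K < 2^m`, the pattern whose bit `p` is bit `σ p` of `K`; indices `≥ 2^m` (the variable `x_D = δ`) are fixed. -/
def pull (m : ℕ) (σ : ℕ → ℕ) (K : ℕ) : ℕ := if K < 2 ^ m then code m (fun p => tb K (σ p)) else K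

/-- The relays `x < m` sorted STABLY by their membership class w.r.t. the pair `(i, j)`: first those cut in both, then in `i` only, then in `j` only,
then in neither (for `i` or `j = 2^m`, i.e. `δ`, no relay is «cut in» it). -/
def classList (m i j : ℕ) : List ℕ :=
  let l := List.range m
  let r₁ := l.filter fun x => !(tb i x && tb j x)
  let r₂ := r₁.filter fun x => !(tb i x)
  l.filter (fun x => tb i x && tb j x) ++ (r₁.filter (fun x => tb i x) ++ (r₂.filter (fun x => tb j x) ++ r₂.filter (fun x => !(tb j x))))

/-- The canonical relabelling of the pair `(i, j)` as a function on `ℕ` (position `p ↦` relay; identity beyond `m`). -/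
def unrank (m i j : ℕ) (p : ℕ) : ℕ := (classList m i j).getD p p

/-- **The canonical form of the ordered pair `(i, j)`** under relabelling. -/
def canonPair (m i j : ℕ) : ℕ × ℕ := (pull m (unrank m i j) i, pull m (unrank m i j) j)

/-- Number of relays `x < m` cut in `i` but not in `j`. -/
def excl (m i j : ℕ) : ℕ := ((List.range m).filter fun x => tb i x && !(tb j x)).length

/-- Base-`N` code of a pair. -/
def enc2 (N : ℕ) (p : ℕ × ℕ) : ℕ := p.2 + N * p.1

/-- **The orbit key of the monomial `x_i x_j`** (`N = 2^m + 1` variables): the code of the canonical form of `(i, j)` or of `(j, i)`, oriented so that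
`(i, j)` and `(j, i)` receive the same key. -/
def keyS (m i j : ℕ) : ℕ :=
  enc2 (2 ^ m + 1) (if excl m i j ≤ excl m j i then canonPair m i j else canonPair m j i)

/-! ### The certificates -/

/-- A symmetrised degree-2 certificate: the cell parameters (`base.m, base.h, base.cN, base.cD`; the lists and `fam` of `base` play no role),
the multiplier `ℓ = Σ n·x_b` of the conclusion (`ell`), marginal slacks `n·(x_D − m_x)·x_b` (`lin`), van den Berg–Kahn rows and squares (chunked). -/
structure SymCert where
  /-- `m, h, cN, cD` -/
  base : Cert
  /-- `(b, n)`: `n·(cN·x_D − cD·T)·x_b` -/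
  ell : List (ℕ × ℕ)
  /-- `(x, b, n)`: `n·(x_D − m_x)·x_b` -/
  lin : List (ℕ × ℕ × ℕ)
  /-- rows (one representative per orbit suffices), chunked -/
  rows : List (List RowE)
  /-- squares, chunked -/
  sqs : List (List SqE)

namespace SymCert

variable (c : SymCert)

/-- Number of variables. -/
abbrev NV : ℕ := c.base.NV

/-- The key of `x_i x_j` for this certificate's `m`. -/
abbrev key (i j : ℕ) : ℕ := keyS c.base.m i j

/-- Contributions of an `ell` entry (LHS, positive): `n·cN` at `x_D x_b`, `−n·cD` at `x_i x_b` for `i ∈ T`. -/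
def ellC (e : ℕ × ℕ) : List (ℕ × ℤ) :=
  (c.key c.base.D e.1, (e.2 : ℤ) * c.base.cN) :: (suppOf c.NV c.base.tMem).map fun i => (c.key i e.1, -((e.2 : ℤ) * c.base.cD))

/-- Contributions of a `lin` entry (RHS, entered negated): `−n` at `x_D x_b`, `+n` at `x_i x_b` for `i ∋ x`. -/
def linC1 (e : ℕ × ℕ × ℕ) : List (ℕ × ℤ) :=
  (c.key c.base.D e.2.1, -(e.2.2 : ℤ)) :: (suppOf c.NV (c.base.margMem e.1)).map fun i => (c.key i e.2.1, (e.2.2 : ℤ))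

/-- Contributions of the product of two mask forms with coefficient `z`. -/
def prodCS (m1 m2 : ℕ) (z : ℤ) : List (ℕ × ℤ) :=
  ((suppOf c.NV (tb m1)).map fun i => (suppOf c.NV (tb m2)).map fun j => (c.key i j, z)).flatten

/-- Contributions of a row (RHS, negated): `−n` on `f₃⊗f₄`, `+n` on `f₁⊗f₂`. -/
def rowCS (r : RowE) : List (ℕ × ℤ) := c.prodCS r.m3 r.m4 (-(r.n : ℤ)) ++ c.prodCS r.m1 r.m2 (r.n : ℤ)

/-- Contributions of a square (RHS, negated): `−n·u_i·u_j` over the support of `u`. -/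
def sqCS (s : SqE) : List (ℕ × ℤ) :=
  ((suppOf c.NV (tb (s.m1 ||| s.m2))).map fun i =>
    (suppOf c.NV (tb (s.m1 ||| s.m2))).map fun j => (c.key i j, -((s.n : ℤ) * s.u i * s.u j))).flatten

/-- **All contributions** (LHS positive, RHS negative), filed under orbit keys. -/
def contribsS : List (ℕ × ℤ) :=
  (c.ell.map c.ellC).flatten ++ (c.lin.map c.linC1).flatten ++
    (c.rows.map fun ch => (ch.map c.rowCS).flatten).flatten ++ (c.sqs.map fun ch => (ch.map c.sqCS).flatten).flatten

/-- The `x_D`-weight of `ℓ`. -/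
def ellDS : ℕ := (c.ell.map fun e => if e.1 = c.base.D then e.2 else 0).sum

/-- **The structural check**: `cD > 0`, `h ≥ 1`, `ℓ_D > 0`, all variables `< NV`, relay indices `< m`, rows well formed. -/
def checkWS : Bool :=
  decide (0 < c.base.cD) && decide (1 ≤ c.base.h) && decide (0 < c.ellDS) &&
    c.ell.all (fun e => decide (e.1 < c.NV)) &&
    c.lin.all (fun e => decide (e.1 < c.base.m) && decide (e.2.1 < c.NV)) &&
    c.rows.all (fun ch => ch.all fun r => c.base.rowOK r)

/-- **The key check**: sort all contributions by orbit key and scan the runs — every orbit has a nonnegative coefficient sum. -/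
def checkQS (fuel : ℕ) : Bool := runsOK (msort2 fuel c.contribsS)

/-- **The full check.** -/
def checkS (fuel : ℕ) : Bool := c.checkWS && c.checkQS fuel

/-- The number of contributions (diagnostic). -/
def nContribs : ℕ := c.contribsS.length

end SymCert


/-! ### Objects of the soundness proof (`…QCertSymSound`, `…QCertSymPerm`): symmetrised moments, relabellings, the canonical permutation -/

section SoundnessObjects

variable {G : Type*} [Fintype G]

/-- The symmetrised second moment `Σ_g v_g(i)·v_g(j)` of a finite family of points. -/
noncomputable def Msym (v : G → ℕ → ℝ) (i j : ℕ) : ℝ := ∑ g, v g i * v g j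

/-- `Msym` is nonnegative for nonnegative points. -/
theorem Msym_nonneg (v : G → ℕ → ℝ) (hv : ∀ g i, 0 ≤ v g i) (i j : ℕ) : 0 ≤ Msym v i j :=
  Finset.sum_nonneg fun g _ => mul_nonneg (hv g i) (hv g j)

/-- `Msym` is symmetric. -/
theorem Msym_comm (v : G → ℕ → ℝ) (i j : ℕ) : Msym v i j = Msym v j i := by
  unfold Msym; exact Finset.sum_congr rfl fun g _ => mul_comm _ _

/-- The key valuation: `key = b + N·a ↦ Msym v a b`. -/
noncomputable def valS (v : G → ℕ → ℝ) (N key : ℕ) : ℝ := Msym v (key / N) (key % N)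

/-- `valS` is nonnegative for nonnegative points. -/
theorem valS_nonneg (v : G → ℕ → ℝ) (hv : ∀ g i, 0 ≤ v g i) (N key : ℕ) : 0 ≤ valS v N key :=
  Msym_nonneg v hv _ _

end SoundnessObjects

/-! ### A permutation of `Fin m` as a function on `ℕ`; the canonical relabelling is a permutation -/

/-- Extension of `σ : Equiv.Perm (Fin m)` to `ℕ` (identity beyond `m`). -/
def permN {m : ℕ} (σ : Equiv.Perm (Fin m)) (p : ℕ) : ℕ := if h : p < m then (σ ⟨p, h⟩ : ℕ) else p

/-- `classList m i j` is a permutation of `range m`. -/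
theorem classList_perm (m i j : ℕ) : (classList m i j).Perm (List.range m) := by
  have h3 : List.Perm ((((List.range m).filter fun x => !(tb i x && tb j x)).filter fun x => !(tb i x)).filter (fun x => tb j x) ++
      (((List.range m).filter fun x => !(tb i x && tb j x)).filter fun x => !(tb i x)).filter (fun x => !(tb j x)))
      (((List.range m).filter fun x => !(tb i x && tb j x)).filter fun x => !(tb i x)) := List.filter_append_perm _ _
  have h2 := (List.Perm.append_left (((List.range m).filter fun x => !(tb i x && tb j x)).filter fun x => tb i x) h3).trans
    (List.filter_append_perm (fun x => tb i x) ((List.range m).filter fun x => !(tb i x && tb j x)))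
  exact (List.Perm.append_left ((List.range m).filter fun x => tb i x && tb j x) h2).trans (List.filter_append_perm _ _)

/-- Length `m`. -/
theorem classList_length (m i j : ℕ) : (classList m i j).length = m := by
  rw [(classList_perm m i j).length_eq, List.length_range]

/-- Entries `< m`. -/
theorem classList_getElem_lt (m i j : ℕ) (p : ℕ) (hp : p < (classList m i j).length) : (classList m i j)[p] < m :=
  List.mem_range.1 ((classList_perm m i j).mem_iff.1 (List.getElem_mem hp))

/-- The canonical relabelling on `Fin m`. -/
def classFun (m i j : ℕ) (p : Fin m) : Fin m :=
  ⟨(classList m i j)[p.1]'(by rw [classList_length]; exact p.2), classList_getElem_lt m i j _ _⟩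

/-- It is injective (the list has no duplicates). -/
theorem classFun_injective (m i j : ℕ) : Function.Injective (classFun m i j) := by
  intro p q h
  have h' : (classList m i j)[p.1]'(by rw [classList_length]; exact p.2) = (classList m i j)[q.1]'(by rw [classList_length]; exact q.2) :=
    congrArg Fin.val h
  exact Fin.ext (((classList_perm m i j).nodup_iff.2 List.nodup_range).getElem_inj_iff.1 h')

/-- **The canonical relabelling as a permutation of `Fin m`.** -/
noncomputable def classPerm (m i j : ℕ) : Equiv.Perm (Fin m) :=
  Equiv.ofBijective (classFun m i j) (Finite.injective_iff_bijective.1 (classFun_injective m i j))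

/-! ### The family of relabelled cut laws of an enumeration of relays -/

section LawFamily

open Literature.Probability.LatticeModels (prodBernoulli)
open Literature.Probability.Percolation

variable {n k : ℕ}

/-- The family of cut laws of all relabellings of an enumeration. -/
noncomputable def lawFam (w : Sym2 (Fin n) → unitInterval) (a₀ : Fin n) (t : Fin k → Fin n) (δ : ℝ) (g : Equiv.Perm (Fin k)) : ℕ → ℝ :=
  lawvK w a₀ (t ∘ g) δ

end LawFamily

/-! ### Smoke test: the trivial certificate `T ≤ m·x_D` by the marginals alone, `(m, h) = (2, 1)`, `c = 2` -/

/-- `(2,1)`, `c = 2/1`: `2·x_D − T = (x_D − m_0) + (x_D − m_1) + x_{11}`, multiplied by `x_D`. -/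
def symSmoke : SymCert := ⟨⟨2, 1, 2, 1, 1, [], [], []⟩, [(4, 1)], [(0, 4, 1), (1, 4, 1)], [], []⟩

/-- The smoke certificate passes. -/
theorem symSmoke_check : symSmoke.checkS 8 = true := by decide +kernel

/-- Orbit keys identify relabelled pairs: `x_{01} x_{10}` and `x_{10} x_{01}`, `x_{01}x_D` and `x_{10}x_D` (`m = 2`, `D = 4`). -/
theorem keyS_examples : keyS 2 1 2 = keyS 2 2 1 ∧ keyS 2 1 4 = keyS 2 2 4 ∧ keyS 2 4 1 = keyS 2 2 4 ∧ keyS 2 3 1 = keyS 2 2 3 ∧ keyS 2 1 1 ≠ keyS 2 1 2 := by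
  decide +kernel

end QCert
end HubOnly

end Summit.CriticalPhenomena.PercolationContinuityZ3.Theorems
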